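import Summits.Ventures.HodgeRepro2.T6N41Shapes
import Summits.Ventures.HodgeRepro2.T5GammaFactor

/-!
# T6N41Arch — the archimedean factors of N4.1 from the Γ_ℂ-product shape (M2 composition glue, carrier-free)

The `harch` binder of `T6N41Main.N41_main` asks, for each archimedean place `v ∈ A`, that the datum's factor
`D.Lv v = L(s, π_v × χ_{V,v})` be meromorphic on `ℂ` and zero-free at `1` (`meromorphicOrderAt … 1 ≤ 0`).  At the
M2 composition this factor is t6-p6's `ArchDoublingDatum.Lfac` (compat field of `NAut`), whose shape is the
display `T6N43Hyp.EischenLiu2024_Sec2_2`: a product of Γ_ℂ-factors `Γ_ℂ(s + c) = 2 (2π)^{−(s+c)} Γ(s + c)`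
(p1's `T5GammaFactor.GammaC`).  This file discharges `harch` from that SHAPE, for arbitrary shifts `c_j`, `d_j`:

* `meromorphicOn_GammaC_shift`, `meromorphicOrderAt_GammaC_shift_le_zero` — one factor `s ↦ Γ_ℂ(s + c)` is
  meromorphic on `ℂ` of order `≤ 0` at every point (the prefactor `2 (2π)^{−(s+c)}` is entire and non-vanishing;
  `Γ(s + c)` is `T6N41Core.meromorphicOrderAt_Gamma_affine_le_zero` with `a = 1`);
* `archimedean_hyp_of_gammaC_shape` — `L s = (∏_j Γ_ℂ(s + c_j)) · ∏_j Γ_ℂ(s + d_j)` ⟹ `MeromorphicOn L univ ∧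
  meromorphicOrderAt L x ≤ 0` for every `x` (in particular `x = 1`).

Nothing is displayed here (TARGET-T6 §7(c)); t6-p6's display is consumed by the composition, not re-typed.
§8(d): uses an L-value-free non-vanishing device: NO.
-/

namespace Summit.Ventures.HodgeRepro2.T6
namespace N41Core

open Summit.Ventures.HodgeRepro2.T5OrderCounting

/-- `Γ_ℂ(s + c) = (2 (2π)^{−(s+c)}) · Γ(1 · s + c)`, as functions of `s`. -/
theorem gammaC_shift_eq (c : ℂ) :
    (fun s : ℂ => T5GammaFactor.GammaC (s + c)) =
      (fun s : ℂ => 2 * (2 * (Real.pi : ℂ)) ^ (-(s + c))) * fun s : ℂ => Complex.Gamma (1 * s + c) := by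
  funext s
  simp [T5GammaFactor.GammaC, Pi.mul_apply]

/-- The prefactor `s ↦ 2 (2π)^{−(s+c)}` is entire. -/
theorem analyticOnNhd_gammaC_prefactor (c : ℂ) :
    AnalyticOnNhd ℂ (fun s : ℂ => 2 * (2 * (Real.pi : ℂ)) ^ (-(s + c))) Set.univ := by
  intro x _
  have hpos : (0 : ℝ) < 2 * Real.pi := by positivity
  have h : AnalyticAt ℂ (fun s : ℂ => ((2 * Real.pi : ℝ) : ℂ) ^ (-(s + c))) x :=
    analyticAt_const.cpow (analyticAt_id.add analyticAt_const).neg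
      (Complex.ofReal_mem_slitPlane.2 hpos)
  have h2 : AnalyticAt ℂ (fun s : ℂ => (2 * (Real.pi : ℂ)) ^ (-(s + c))) x := by
    simpa [Complex.ofReal_mul] using h
  exact analyticAt_const.mul h2

/-- The prefactor `2 (2π)^{−(s+c)}` never vanishes. -/
theorem gammaC_prefactor_ne_zero (c s : ℂ) : 2 * (2 * (Real.pi : ℂ)) ^ (-(s + c)) ≠ 0 :=
  mul_ne_zero two_ne_zero (T5GammaFactor.two_pi_cpow_ne_zero _)

/-- `s ↦ Γ_ℂ(s + c)` is meromorphic on `ℂ`. -/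
theorem meromorphicOn_GammaC_shift (c : ℂ) :
    MeromorphicOn (fun s : ℂ => T5GammaFactor.GammaC (s + c)) Set.univ := by
  rw [gammaC_shift_eq]
  exact (analyticOnNhd_gammaC_prefactor c).meromorphicOn.mul (meromorphicOn_Gamma_affine 1 c)

/-- `s ↦ Γ_ℂ(s + c)` has order `≤ 0` at every point (zero-free: `Γ` has no zeros). -/
theorem meromorphicOrderAt_GammaC_shift_le_zero (c x : ℂ) :
    meromorphicOrderAt (fun s : ℂ => T5GammaFactor.GammaC (s + c)) x ≤ 0 := by
  rw [gammaC_shift_eq, meromorphicOrderAt_mul ((analyticOnNhd_gammaC_prefactor c) x trivial).meromorphicAt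
    (meromorphicAt_Gamma_affine 1 c x),
    meromorphicOrderAt_eq_zero_of_ne_zero ((analyticOnNhd_gammaC_prefactor c) x trivial)
      (gammaC_prefactor_ne_zero c x), zero_add]
  exact meromorphicOrderAt_Gamma_affine_le_zero one_ne_zero c x

/-- A finite product `s ↦ ∏_j Γ_ℂ(s + c_j)`, as a product of functions. -/
theorem gammaC_prod_eq {n : ℕ} (c : Fin n → ℂ) :
    (fun s : ℂ => ∏ j, T5GammaFactor.GammaC (s + c j)) =
      ∏ j, (fun s : ℂ => T5GammaFactor.GammaC (s + c j)) := by
  funext s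
  simp [Finset.prod_apply]

/-- A finite product of Γ_ℂ-factors is meromorphic on `ℂ`. -/
theorem meromorphicOn_gammaC_prod {n : ℕ} (c : Fin n → ℂ) :
    MeromorphicOn (fun s : ℂ => ∏ j, T5GammaFactor.GammaC (s + c j)) Set.univ := by
  rw [gammaC_prod_eq]
  exact meromorphicOn_prod fun j _ => meromorphicOn_GammaC_shift (c j)

/-- A finite product of Γ_ℂ-factors has order `≤ 0` at every point. -/
theorem meromorphicOrderAt_gammaC_prod_le_zero {n : ℕ} (c : Fin n → ℂ) (x : ℂ) :
    meromorphicOrderAt (fun s : ℂ => ∏ j, T5GammaFactor.GammaC (s + c j)) x ≤ 0 := by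
  rw [gammaC_prod_eq]
  exact meromorphicOrderAt_prod_nonpos (fun j _ => meromorphicOn_GammaC_shift (c j) x trivial)
    (fun j _ => meromorphicOrderAt_GammaC_shift_le_zero (c j) x)

/-- **The `harch` binder from the Γ_ℂ-product shape.** If `L s = (∏_j Γ_ℂ(s + c_j)) · ∏_j Γ_ℂ(s + d_j)` for all
`s` (the shape of t6-p6's display `EischenLiu2024_Sec2_2` for the datum's archimedean factor), then `L` is
meromorphic on `ℂ` and of order `≤ 0` at every `x`. -/
theorem archimedean_hyp_of_gammaC_shape {a b : ℕ} (c : Fin a → ℂ) (d : Fin b → ℂ) {L : ℂ → ℂ}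
    (hL : ∀ s : ℂ, L s = (∏ j, T5GammaFactor.GammaC (s + c j)) * ∏ j, T5GammaFactor.GammaC (s + d j))
    (x : ℂ) : MeromorphicOn L Set.univ ∧ meromorphicOrderAt L x ≤ 0 := by
  have hfun : L = (fun s : ℂ => ∏ j, T5GammaFactor.GammaC (s + c j)) *
      fun s : ℂ => ∏ j, T5GammaFactor.GammaC (s + d j) := by
    funext s
    rw [hL s]
    rfl
  rw [hfun]
  refine ⟨(meromorphicOn_gammaC_prod c).mul (meromorphicOn_gammaC_prod d), ?_⟩
  rw [meromorphicOrderAt_mul (meromorphicOn_gammaC_prod c x trivial)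
    (meromorphicOn_gammaC_prod d x trivial)]
  exact add_nonpos (meromorphicOrderAt_gammaC_prod_le_zero c x)
    (meromorphicOrderAt_gammaC_prod_le_zero d x)

end N41Core
end Summit.Ventures.HodgeRepro2.T6
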